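import Summits.FinalStateConjecture.FinalStateConjecture.Theorems.BartnikGapSettlingBondiBartnikRigidityMarchingLemmaMarchStep
import Summits.FinalStateConjecture.FinalStateConjecture.Theorems.BartnikGapSettlingBondiBartnikRigidityMarchingLemmaMarchSetup
import Summits.FinalStateConjecture.FinalStateConjecture.Theorems.BartnikGapSettlingBondiBartnikRigidityMarchingLemmaCollarChartOrientation
import HarnessLib

/-!
# K2b-5 `stub_marchingLemma`: the MARCHING LEMMA of line `direct-method-on-the-cone`
# (crux `BondiBartnikRigidity`, stmt-FinalStateConjecture-10807)

`stub_marchingLemma : SlabFutureContainsCylinder → SlabFrontier → ExactChartPastSet → ExactChartGluing →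
choquetBruhat_geroch_exists_mghd_cauchy → MarchingLemma` — the registered stub of the line, proved by the
SPACELIKE MARCHING of the worker's report (bricks 1–24, all landed as
`…BondiBartnikRigidityMarchingLemma*.lean`): the typed reduction `Marching.marchingLemma_of_step` (brick 1)
to the invariant `Inv τ` ("an exact, time-orientation preserving open embedding of
`pullK ((W ∩ {t* < τ}) ∪ F)` into `J⁺(C)`, equal to the boundary collar chart `Ψ_E` on
`pullK (F ∪ slab ∪ (O ∩ roofK))`"), the march data (brick 23), the base case `Inv (η/2)` (the domain is
the collar set `F`, on which `Ψ_E` is exact and — brick 24 — time-orientation preserving), and the step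
`Inv τ → Inv (τ + h/2)` (brick 22; below `2h` the domain does not change).

References: Dafermos–Rodnianski arXiv:0811.0354, §5.1 [DafermosRodnianski2008]; Choquet-Bruhat–Geroch 1969,
Thm. 3 [ChoquetBruhatGeroch1969CMP]; Sbierski 2016, §3.1 [Sbierski2016AHP]; Hawking–Ellis 1973, §6.5
[HawkingEllis1973CUP].  No definitions, no named facts.
-/

noncomputable section

-- D-0017: single-problem summit, `Summit.<S>.<S>.…` by design (cf. lakefile `weak.linter.dupNamespace`).
set_option linter.dupNamespace false
set_option maxSynthPendingDepth 3

open Set Filter Function Topology TopologicalSpace Metric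
open Literature.Geometry.Lorentzian
open scoped Manifold ContDiff Topology ENNReal

namespace Summit.FinalStateConjecture.FinalStateConjecture.Theorems.BondiBartnikRigidity.DirectMethod

open K2Route
open FutureK (translate_mem_region)

set_option maxHeartbeats 3200000 in
/-- **MARCHING LEMMA** (K2b-5 `stub_marchingLemma` of line `direct-method-on-the-cone`): under the
hypotheses of `RoofDevelopmentExtensionCollar`, for every `T₀` there is an exact chart of the collar
background on the pull-back of `J⁺_K(slab)° ∩ {t* < τ}` for some `τ > T₀`, with image in `J⁺(C)` —
conditional on the two Kerr causal facts, the past-set transfer and chart-gluing lemmas, and the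
Choquet-Bruhat–Geroch theorem.  Proof: spacelike marching (see the module docstring).
[cite: DafermosRodnianski2008, §5.1] -/
theorem stub_marchingLemma : K2Route.SlabFutureContainsCylinder → K2Route.SlabFrontier → K2Route.ExactChartPastSet →
    K2Route.ExactChartGluing → choquetBruhat_geroch_exists_mghd_cauchy → K2Route.MarchingLemma := by
  intro hSFC hSF hPast hGlue hCBG
  refine Marching.marchingLemma_of_step ?_ hSFC hSF hPast hGlue hCBG
  intro h1 h2 h3 h4 h5 _ k' hk' X _ _ _ _ _ _ D 𝒱 M a p mo B Φ hmax hpar hp hB hΦ hdev hor hCX hcoll T₀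
  classical
  have hM := (hpar 0).1
  have ha := (hpar 0).2
  have hcyl := h1 (M 0) (a 0) hM ha
  have hfr := h2 (M 0) (a 0) hM ha
  set W := interior (JK (M 0) (a 0) hM (slabK (M 0) (a 0))) with hWdef
  -- the rest-frame labelling `lab z = Λ z + c`
  have hdom : ((B 0).domain : Set E4) = poincareInv (mo 0).1 (mo 0).2 ⁻¹' (Kerr.region (a 0) (M 0) : Set E4) := by
    rw [hB 0]; rfl
  have hlabmem : ∀ z : Kerr.region (a 0) (M 0), ((mo 0).1 : E4 ≃L[ℝ] E4) z.1 + (mo 0).2 ∈ (B 0).domain := by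
    intro z
    show ((mo 0).1 : E4 ≃L[ℝ] E4) z.1 + (mo 0).2 ∈ ((B 0).domain : Set E4)
    rw [hdom, mem_preimage, F1Route.poincareInv_lab (mo 0) z.1]
    exact z.2
  set lab : Kerr.region (a 0) (M 0) → (B 0).domain := fun z => ⟨((mo 0).1 : E4 ≃L[ℝ] E4) z.1 + (mo 0).2, hlabmem z⟩
    with hlabdef
  have hlab : ∀ z, (lab z : E4) = ((mo 0).1 : E4 ≃L[ℝ] E4) z.1 + (mo 0).2 := fun z => rfl
  -- the datum side
  have hCslab : Φ 0 '' pullK (mo 0) (M 0) (a 0) (B 0) (slabK (M 0) (a 0)) ⊆ collarCore M p B Φ :=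
    Marching.image_pullK_slabK_subset_collarCore M a p mo B Φ hB
  /- ### the march data -/
  obtain ⟨O, F, ΨE, h, η, w₀, ρ, T₁, ⟨hh, hhM, hhη, hη, hη1, hT₁, hT₁w, hw₀, hρ₁, hρ₂⟩, hF, hOρ, hFE, hEo, hsE, heE, himgE,
    hdE, hcontE, hroofE, hslabE, hnearF, hlocF, hlow⟩ := SetupK.march_setup hM ha hcyl hfr (hcoll) T₀
  have hFo : IsOpen F := CollarK.isOpen_collarSet hM hfr hF
  have hFW : F ⊆ W := fun x hx => ((hF x).1 hx).1
  -- the orientation of the boundary collar chart on the collar set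
  have htopF : ∀ x ∈ pullK (mo 0) (M 0) (a 0) (B 0) F, 𝒱.timeOrientation.IsFutureDirected
      (mfderiv 𝓘(ℝ, E4) (𝓡 4) ΨE x (((mo 0).1 : E4 ≃L[ℝ] E4) (Kerr.timeVector (M 0) (a 0)
        (poincareInv (mo 0).1 (mo 0).2 x.1)))) := by
    rintro x ⟨hreg, hxF⟩
    set z : Kerr.region (a 0) (M 0) := ⟨poincareInv (mo 0).1 (mo 0).2 x.1, hreg⟩ with hz
    have hxz : lab z = x := Subtype.ext (F1Route.lab_poincareInv (mo 0) x.1)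
    have key := OrientK.collar_isFutureDirected 𝒱 hM ha (hB 0) hlab hcyl hfr hCslab hCX hη1 hw₀ hρ₁ hF hEo hFE hOρ
      hsE himgE hdE hcontE hroofE hslabE z hxF
    rw [(ChartData.contMDiffAt_chart hlab hEo (hB 0) hsE (hFE hxF)).2] at key
    have hgen : ∀ x' : (B 0).domain, x' = lab z → 𝒱.timeOrientation.IsFutureDirected
        (mfderiv 𝓘(ℝ, E4) (𝓡 4) ΨE x' (((mo 0).1 : E4 ≃L[ℝ] E4) (Kerr.timeVector (M 0) (a 0)
          (poincareInv (mo 0).1 (mo 0).2 x'.1)))) := by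
      rintro _ rfl
      rw [show poincareInv (mo 0).1 (mo 0).2 (lab z).1 = z.1 from F1Route.poincareInv_lab (mo 0) z.1]
      exact key
    exact hgen x hxz.symm
  -- domains below `η` are the collar set
  have hdomF : ∀ τ, τ ≤ η → W ∩ {y | y.1 0 < τ} ∪ F = F := fun τ hτ =>
    union_eq_right.2 fun x hx => hlow x hx.1 (lt_of_lt_of_le hx.2 hτ)
  /- ### the invariant: base case and step -/
  refine ⟨O, F, ΨE, h / 2, η / 2, by positivity, ?_, ?_⟩
  · -- base case `Inv (η/2)`: the chart `Ψ_E` on `pullK F`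
    beta_reduce
    rw [hdomF (η / 2) (by linarith)]
    obtain ⟨hsF, heF, himgF, hdF⟩ := K2Route.exactOn_pullK_mono (hB 0) hsE heE himgE hdE hFE hFo
    exact ⟨ΨE, hsF, heF, himgF, hdF, htopF, fun x _ => rfl⟩
  · -- the step
    intro τ hτT₀ hInv
    obtain ⟨Ψ, hs, he, himg, hd, htop, hbdry⟩ := hInv
    by_cases hτ : 2 * h ≤ τ
    · exact StepK.march_step hCBG hGlue hPast 𝒱 hmax hM ha (hB 0) hlab hcyl hfr hCslab hCX hh hhM hT₁w hρ₂ hF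
        (E' := slabDiamondHalfK (M 0) (a 0) ∪ (O ∩ W) ∪ slabK (M 0) (a 0) ∪ (O ∩ roofK (M 0) (a 0) hM))
        (fun x hx => Or.inl (Or.inl (hFE hx))) (fun y hy => Or.inr ⟨hOρ hy, hy.1⟩) (fun y hy => Or.inl (Or.inr hy))
        hcontE hslabE (fun q ⟨x, hx, hqx⟩ => hroofE ⟨x, ⟨hx.1, hOρ hx.2, hx.2.1⟩, hqx⟩) hnearF hlocF hτ
        (by linarith [le_max_left T₀ 0]) hs he himg hd htop hbdry hOρ
    · -- below `2h` the domain is `F` before and after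
      push Not at hτ
      have h1 : τ ≤ η := by linarith
      have h2 : τ + h / 2 ≤ η := by linarith
      rw [hdomF τ h1] at hs he himg hd htop
      beta_reduce
      rw [hdomF (τ + h / 2) h2]
      exact ⟨Ψ, hs, he, himg, hd, htop, hbdry⟩

end Summit.FinalStateConjecture.FinalStateConjecture.Theorems.BondiBartnikRigidity.DirectMethod

end
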